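/-
Origin: expansion seat `prover-pub-hodgecm-mc-binder-2-g12-0`, handover #50 2026-08-20T04:40Z md5 6820c8b646cd (395 l.; CERTIFIED private mirror over PKG RUN-39 oleans, elan lean 4.32.0 `-DautoImplicit=false`: rc 0 / 0 err / 0 warn / 34.2 s; `#print axioms` of letterSection_lett · lett · cmPlaceComponent_fst_mem_range · eq_of_cmPlaceComponent_eq · archAt_cmPlace_eq_archLocalOfEmb · UForm.mem_range_kV_of_apply_eq_zero ⊆ {propext, Classical.choice, Quot.sound}; imports #41 `HypCensus/LetterSection`, #40 `HypCensus/ArchFrameConj` (RUN 39), carch-1 `Model/ArchKTypeOfFrameMatch` (RUN 38), binder-1 `Model/Junction/KInftySplit` (RUN 37), discharge-4 `HypCensus/DefiniteVacuumExponent` (RUN 36); (J-x₀) step (c) = input (c) of #48/#49 CONSTRUCTED at the ball frame of record `KInfty V = archIsotropy L V.Hm ι₁ V.sylvesterFrame _`: §1 `UForm.mem_range_kV_of_apply_eq_zero` (block-diagonal element of U(P,Q) ⇒ compact letter `kV (a,b)`), `UForm.kV_injective`; §2 `cmPlaceComponent_fst/_snd` (place components of an archimedean pair element = `toUForm ε_v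 …` of its `archAt (cmPlaceOver v)` components), `coe_cmPlaceComponent_fst` (matrix `reindex ε ε (scaleConj D x_w)`), **`eq_of_cmPlaceComponent_eq`** (an archimedean pair element is determined by its place components; `archPiEquiv` injectivity + `toUForm_bijective` + `cmPlaceOver_cmPlaceUnder`), `letterSection_eq_of_κ_eq`; §3 **`archAt_cmPlace_eq_archLocalOfEmb`** (the `w(τ)`-component of ANY `k ∈ U(H)(L⊗ℝ)` is `archLocalOfEmb (formEquivU21⁻¹ (π_τ k))` — tree `archLocalOfEmb_archAtEmb`; NO generation lemma for K_∞ needed), `coe_archAt_cmPlace`; §4 `cmPlaceComponent_snd_one`, `cmPlaceComponent_fst_mem_range_of_ne` (off ι₁: `kV_surjective_of_isEmpty` + `isEmpty_posIdx_or_negIdx_placeSignVec`), `archFrameConj_eq_archFrameCongr` (binder-2 #40 = carch-1 #CA2, via `archToAdelic_archFrameCongr`/`cmKTypeHom_archToAdelic`), `coe_archAt_cmPlace_archFrameConj` (the `w(ι₁)`-matrix of `frameG⁻¹ k frameG` for ANY k = carch-1 #CA8 `coe_map_embTwist_frameConj` at `u := π k`), **`cmPlaceComponent_fst_mem_range_cmPlace`**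 (at ι₁, k ∈ K_∞: `π k • x₀ = x₀` ⇒ `mat_col/row_two_eq_zero_of_smul_x₀` ⇒ the framed matrix is block-diagonal in `ε = signSplit`, via #CA8 `eq_perm_two_of_not_pos`/`perm_symm_ne_last_of_pos`), `cmPlaceComponent_fst_mem_range` (every place); §5 `kPairHom` (= #48's `kPair` as a hom on `KInfty V`), `lettAt v` (`(MonoidHom.ofInjective kV_injective)⁻¹ ∘ codRestrict`), `kV_lettAt`, **`lett V S : KInfty V →* Π_w U(V⁺_w) × U(V⁻_w)`**, `κ_lett_apply` (`κ (lett k w, (1,1)) = cmPlaceComponent w (frameG⁻¹ k frameG, 1)`), **`letterSection_lett : letterSection (kVLetters (lett V S k)) = (archFrameConj frameG k, 1)`** (= #48/#49's `hlett`, PROVED); 0 Prop-defs / 0 records / 0 proof-hole-class tokens; FQN scan vs PKG RUN-40 world + p-g15 stage41 = 0 collisions; NAME LIST `HodgeCM.Model.HypCensus.letterSection_lett` · `HodgeCM.Model.HypCensus.cmPlaceComponent_fst_mem_range` · `HodgeCM.Model.HypCensus.eq_of_cmPlaceComponent_eq`) (`HOME/mc/pub-hodgecm-mc-binder-2/g12/pkg/HodgeCM/Model/HypCensus/KInfLetters.lean`,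 md5 6820c8b646cd, 395 lines);
landed by the gen-15 packager (p-g15) in gate run 41 as `HodgeCM/Model/HypCensus/KInfLetters.lean` (verbatim).
-/
/-
Origin: speedrun cell pub-hodgecm, MODEL-CONSTRUCTION sub-cell, lineage mc-binder-2 (BINDER-OWNERS rows 18/19: E binders
`hyp12` / `hyp34`), seat prover-pub-hodgecm-mc-binder-2-g12-0 (gen 12), 2026-08-20.
Target in PKG: `HodgeCM/Model/HypCensus/KInfLetters.lean` (NEW additive leaf; imports this lineage's `HypCensus/LetterSection` (#41, RUN 39),
`HypCensus/ArchFrameConj` (#40, RUN 39), carch-1's `Model/ArchKTypeOfFrameMatch` (RUN 38) and binder-1's `Model/Junction/KInftySplit` (RUN 37)).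
KERNEL ONLY: 0 records, nothing cited as hypothesis, 0 `def … : Prop`.
-/
import Summits.HodgeConjecture.HodgeCM.Model.HypCensus.LetterSection
import Summits.HodgeConjecture.HodgeCM.Model.HypCensus.ArchFrameConj
import Summits.HodgeConjecture.HodgeCM.Model.ArchKTypeOfFrameMatch_2
import Summits.HodgeConjecture.HodgeCM.Model.Junction.KInftySplit
import Summits.HodgeConjecture.HodgeCM.Model.HypCensus.DefiniteVacuumExponent_2

/-!
# Census kit (rows A12/A34), junction (J-x₀) step (c): THE LETTERING OF `K_∞` — `lett` and `hlett` CONSTRUCTED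

#48/#49 (`InsMemPin`, `InsMemDatumAt`) reduce the census field `ins_mem` at the W pin of record to (c) a lettering homomorphism
`lett : K_∞ →* Π_w U(V⁺_w) × U(V⁻_w)` with `hlett : letterSection (kVLetters (lett k)) = (frameG⁻¹ k frameG, 1)` and (e) ONE value identity `hκ`.
This leaf CONSTRUCTS (c) at the frame of record `(τ, T) := (ι₁, V.sylvesterFrame)` (`KInfty V`, binder-1 `Junction/KInftySplit`):

* §1 `UForm.mem_range_kV_of_apply_eq_zero` — a block-diagonal element of `U(P,Q)` is a compact letter `diag(a, b)`;
* §2 `coe_cmPlaceComponent_fst/snd` — the place components of an archimedean pair element ARE the framed local components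
  (`reindex ε (D · x_w · D⁻¹)`), hence `eq_of_cmPlaceComponent_eq` (an archimedean pair element is determined by its place components);
* §3 `archAt_cmPlace_eq_of_archProj` — the `w(ι₁)`-component of ANY `k ∈ U(V.Hm)(L ⊗ ℝ)` is that of the `ι₁`-section of `π k`
  (tree `archLocalOfEmb_archAtEmb`), so `frameG⁻¹ k frameG` has the `w(ι₁)`-matrix of carch-1's `coe_map_embTwist_frameConj` at `u := π k`;
* §4 `cmPlaceComponent_kPair_mem_range` — for `k ∈ K_∞` EVERY place component of `(frameG⁻¹ k frameG, 1)` is a compact letter: off `ι₁` because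
  `V` is definite there (`kV_surjective_of_isEmpty`), at `ι₁` because `π k ∈ Stab(x₀)` is block-diagonal (`mat_col/row_two_eq_zero_of_smul_x₀`)
  and `T = ι₁(frameG) · P_σ · D_s` (carch-1 #CA8);
* §5 **`lett V S : KInfty V →* Π_w U(V⁺_w) × U(V⁻_w)`** (the unique letters, `κ` injective), **`letterSection_kVLetters_lett`** (= `hlett`) and
  `κ_lett_apply` (the letters ARE the place components).

Nothing here is a claim of PerL/QW8.  Style lint (L-notation): no `local notation`.
-/

set_option autoImplicit false

noncomputable section

open NumberField NumberField.InfinitePlace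
open scoped Matrix Classical
open Literature.NumberTheory.Automorphic Literature.NumberTheory.Automorphic.UnitaryGroup Literature.NumberTheory.Weil1964
open Literature.RepresentationTheory.KonnoKonno2007 Literature.RepresentationTheory.KonnoKonno2007.RealDualPair
open Literature.NumberTheory.GelbartRogawski1991 Literature.NumberTheory.GelbartRogawski1991.UnitaryDualPair
open Literature.Analysis.SegalBargmann
open Literature.Geometry.ComplexHyperbolic Literature.Geometry.ComplexHyperbolic.BallModel

namespace HodgeCM.Model.HypCensus

/-! ## §1 Block-diagonal elements of `U(P,Q)` are compact letters -/

section BlockDiagonal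

variable {α β : Type*} [Fintype α] [DecidableEq α] [Fintype β] [DecidableEq β]

/-- **a block-diagonal element of `U(α, β)` lies in the maximal compact `kV (U(α) × U(β))`.** -/
theorem UForm.mem_range_kV_of_apply_eq_zero (g : UForm α β)
    (h₁₂ : ∀ a b, (((g : UForm α β) : GL (α ⊕ β) ℂ) : Matrix (α ⊕ β) (α ⊕ β) ℂ) (Sum.inl a) (Sum.inr b) = 0)
    (h₂₁ : ∀ a b, (((g : UForm α β) : GL (α ⊕ β) ℂ) : Matrix (α ⊕ β) (α ⊕ β) ℂ) (Sum.inr b) (Sum.inl a) = 0) :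
    g ∈ (UForm.kV α β).range := by
  set M : Matrix (α ⊕ β) (α ⊕ β) ℂ := (((g : UForm α β) : GL (α ⊕ β) ℂ) : Matrix (α ⊕ β) (α ⊕ β) ℂ) with hM
  have hblocks : M = Matrix.fromBlocks M.toBlocks₁₁ 0 0 M.toBlocks₂₂ := by
    conv_lhs => rw [← Matrix.fromBlocks_toBlocks M]
    congr 1
    · ext a b; exact h₁₂ a b
    · ext b a; exact h₂₁ a b
  have hU : Mᴴ * signForm α β * M = signForm α β :=
    (mem_unitaryGroupOfForm_star_iff_conjTranspose (signForm α β) _).1 g.2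
  rw [hblocks, Matrix.fromBlocks_conjTranspose, signForm, Matrix.fromBlocks_multiply, Matrix.fromBlocks_multiply] at hU
  simp only [Matrix.conjTranspose_zero, Matrix.zero_mul, Matrix.mul_zero, add_zero, zero_add, Matrix.mul_one,
    Matrix.mul_neg, Matrix.neg_mul] at hU
  obtain ⟨h11, -, -, h22⟩ := Matrix.fromBlocks_inj.1 hU
  rw [neg_inj] at h22
  refine ⟨(⟨M.toBlocks₁₁, Matrix.mem_unitaryGroup_iff'.2 h11⟩, ⟨M.toBlocks₂₂, Matrix.mem_unitaryGroup_iff'.2 h22⟩), ?_⟩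
  apply Subtype.ext
  apply Units.ext
  rw [UForm.coe_kV]
  exact hblocks.symm

/-- `kV` is injective (the blocks of `diag(a, b)` determine `(a, b)`). -/
theorem UForm.kV_injective : Function.Injective (UForm.kV α β) := fun a b h => by
  have h' := congrArg (fun g : UForm α β => (((g : UForm α β) : GL (α ⊕ β) ℂ) : Matrix (α ⊕ β) (α ⊕ β) ℂ)) h
  simp only [UForm.coe_kV] at h'
  obtain ⟨h1, -, -, h2⟩ := Matrix.fromBlocks_inj.1 h'
  exact Prod.ext (Subtype.ext h1) (Subtype.ext h2)

end BlockDiagonal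

/-! ## §2 Place components of an archimedean pair element = its framed local components -/

section Components

variable (L : Type) [Field L] [NumberField L] [IsCMField L] {N M : ℕ}
variable (dV : Fin N → L) (hdV : ∀ i, IsCMField.complexConj L (dV i) = dV i) (hdV0 : ∀ i, dV i ≠ 0)
variable (dW : Fin M → L) (hdW : ∀ i, IsCMField.complexConj L (dW i) = dW i) (hdW0 : ∀ i, dW i ≠ 0)
variable (ι₁ : L →+* ℂ)

/-- the restriction of a (complex) place of the CM field `L` to `L⁺` (a real place). -/
abbrev cmPlaceUnder (w : {w : InfinitePlace L // w.IsComplex}) : {v : InfinitePlace ↥(maximalRealSubfield L) // v.IsReal} :=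
  ⟨w.1.comap (algebraMap ↥(maximalRealSubfield L) L), IsTotallyReal.isReal _⟩

/-- every complex place of the CM field `L` is the chosen place over its restriction to `L⁺`. -/
theorem cmPlaceOver_cmPlaceUnder (w : {w : InfinitePlace L // w.IsComplex}) : cmPlaceOver L (cmPlaceUnder L w) = w :=
  Subtype.ext ((cmPlaceOver_eq_mk L _ w.1.embedding (by rw [mk_embedding])).trans (mk_embedding w.1))

/-- **the `V`-place component IS the Sylvester-framed `w(v)`-component**: `(cmPlaceComponent v p).1 = toUForm ε_v … (p.1)_{w(v)}`. -/
theorem cmPlaceComponent_fst (v : {v : InfinitePlace ↥(maximalRealSubfield L) // v.IsReal})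
    (p : UnitaryGroup.arch (↥(maximalRealSubfield L)) L (IsCMField.complexConj L) N (Matrix.diagonal dV) ×
      UnitaryGroup.arch (↥(maximalRealSubfield L)) L (IsCMField.complexConj L) M (Matrix.diagonal dW)) :
    (cmPlaceComponent L dV hdV hdV0 dW hdW hdW0 ι₁ v p).1 =
      toUForm (cmEpsV L dV hdV ι₁ v) (cmDV_ne_zero L dV hdV hdV0 ι₁ v) (cmSignConv_ne_zero L dV ι₁ v)
        ((formCongr_scaleGL_smul_signForm (cmEpsV L dV hdV ι₁ v) (cmDV_ne_zero L dV hdV hdV0 ι₁ v) (cmSignConv L dV ι₁ v)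
            (cm_htV L dV hdV hdV0 ι₁ v)).trans
          (archLocalForm_diagonal L (IsCMField.complexConj L) N (IsCMField.complexConj_ne_one L) (cmPlaceOver L) (cmPlaceOver_smul L)
            (cmPlaceOver_comap L) (cmRealVec L dV hdV) (realDiagonal_map L dV hdV).symm v).symm)
        (archAt (↥(maximalRealSubfield L)) L (IsCMField.complexConj L) N (Matrix.diagonal dV) (cmPlaceOver L v) (cmPlaceOver_smul L v)
          (IsCMField.complexConj_ne_one L) p.1) := by
  conv_rhs => rw [← archPart_archToAdelic (↥(maximalRealSubfield L)) L (IsCMField.complexConj L) N (Matrix.diagonal dV) p.1]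
  rfl

/-- **the `W`-place component IS the Sylvester-framed `w(v)`-component**: `(cmPlaceComponent v p).2 = toUForm ε_v … (p.2)_{w(v)}`. -/
theorem cmPlaceComponent_snd (v : {v : InfinitePlace ↥(maximalRealSubfield L) // v.IsReal})
    (p : UnitaryGroup.arch (↥(maximalRealSubfield L)) L (IsCMField.complexConj L) N (Matrix.diagonal dV) ×
      UnitaryGroup.arch (↥(maximalRealSubfield L)) L (IsCMField.complexConj L) M (Matrix.diagonal dW)) :
    (cmPlaceComponent L dV hdV hdV0 dW hdW hdW0 ι₁ v p).2 =
      toUForm (cmEpsW L dV dW hdW ι₁ v) (cmDW_ne_zero L dV dW hdW hdW0 ι₁ v) (cmCW_ne_zero L dV ι₁ v)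
        ((formCongr_scaleGL_smul_signForm (cmEpsW L dV dW hdW ι₁ v) (cmDW_ne_zero L dV dW hdW hdW0 ι₁ v) (cmCW L dV ι₁ v)
            (cm_htW L dV dW hdW hdW0 ι₁ v)).trans
          (archLocalForm_diagonal L (IsCMField.complexConj L) M (IsCMField.complexConj_ne_one L) (cmPlaceOver L) (cmPlaceOver_smul L)
            (cmPlaceOver_comap L) (cmRealVec L dW hdW) (realDiagonal_map L dW hdW).symm v).symm)
        (archAt (↥(maximalRealSubfield L)) L (IsCMField.complexConj L) M (Matrix.diagonal dW) (cmPlaceOver L v) (cmPlaceOver_smul L v)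
          (IsCMField.complexConj_ne_one L) p.2) := by
  conv_rhs => rw [← archPart_archToAdelic (↥(maximalRealSubfield L)) L (IsCMField.complexConj L) M (Matrix.diagonal dW) p.2]
  rfl

/-- **the `V`-place component as a MATRIX**: `reindex ε_v ε_v (D_v · (p.1)_{w(v)} · D_v⁻¹)`. -/
theorem coe_cmPlaceComponent_fst (v : {v : InfinitePlace ↥(maximalRealSubfield L) // v.IsReal})
    (p : UnitaryGroup.arch (↥(maximalRealSubfield L)) L (IsCMField.complexConj L) N (Matrix.diagonal dV) ×
      UnitaryGroup.arch (↥(maximalRealSubfield L)) L (IsCMField.complexConj L) M (Matrix.diagonal dW)) :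
    ((((cmPlaceComponent L dV hdV hdV0 dW hdW hdW0 ι₁ v p).1 : UForm (PosIdx (cmXV L dV hdV ι₁ v)) (NegIdx (cmXV L dV hdV ι₁ v))) :
        GL (PosIdx (cmXV L dV hdV ι₁ v) ⊕ NegIdx (cmXV L dV hdV ι₁ v)) ℂ) :
          Matrix (PosIdx (cmXV L dV hdV ι₁ v) ⊕ NegIdx (cmXV L dV hdV ι₁ v)) (PosIdx (cmXV L dV hdV ι₁ v) ⊕ NegIdx (cmXV L dV hdV ι₁ v)) ℂ) =
      Matrix.reindex (cmEpsV L dV hdV ι₁ v) (cmEpsV L dV hdV ι₁ v)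
        (scaleConj (cmDV L dV hdV ι₁ v)
          (((archAt (↥(maximalRealSubfield L)) L (IsCMField.complexConj L) N (Matrix.diagonal dV) (cmPlaceOver L v) (cmPlaceOver_smul L v)
              (IsCMField.complexConj_ne_one L) p.1 : archLocal L N (Matrix.diagonal dV) (cmPlaceOver L v)) : GL (Fin N) ℂ) :
                Matrix (Fin N) (Fin N) ℂ)) := by
  rw [cmPlaceComponent_fst, coe_toUForm]

/-- **an archimedean pair element is determined by its place components.** -/
theorem eq_of_cmPlaceComponent_eq
    {p q : UnitaryGroup.arch (↥(maximalRealSubfield L)) L (IsCMField.complexConj L) N (Matrix.diagonal dV) ×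
      UnitaryGroup.arch (↥(maximalRealSubfield L)) L (IsCMField.complexConj L) M (Matrix.diagonal dW)}
    (h : ∀ v, cmPlaceComponent L dV hdV hdV0 dW hdW hdW0 ι₁ v p = cmPlaceComponent L dV hdV hdV0 dW hdW hdW0 ι₁ v q) : p = q := by
  refine Prod.ext ?_ ?_
  · apply (archPiEquiv (↥(maximalRealSubfield L)) L (IsCMField.complexConj L) N (Matrix.diagonal dV) (IsCMField.complexConj_ne_one L)
      (UnitaryGroup.complexConj_smul_infinitePlace L)).injective
    funext w
    rw [archPiEquiv_apply, archPiEquiv_apply, ← cmPlaceOver_cmPlaceUnder L w]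
    have h1 := congrArg Prod.fst (h (cmPlaceUnder L w))
    rw [cmPlaceComponent_fst, cmPlaceComponent_fst] at h1
    exact (toUForm_bijective _ _ _ _).1 h1
  · apply (archPiEquiv (↥(maximalRealSubfield L)) L (IsCMField.complexConj L) M (Matrix.diagonal dW) (IsCMField.complexConj_ne_one L)
      (UnitaryGroup.complexConj_smul_infinitePlace L)).injective
    funext w
    rw [archPiEquiv_apply, archPiEquiv_apply, ← cmPlaceOver_cmPlaceUnder L w]
    have h2 := congrArg Prod.snd (h (cmPlaceUnder L w))
    rw [cmPlaceComponent_snd, cmPlaceComponent_snd] at h2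
    exact (toUForm_bijective _ _ _ _).1 h2

/-- hence: **a family of letters whose compact images are the place components of `p` letters `p`.** -/
theorem letterSection_eq_of_κ_eq
    (h : ∀ v : {v : InfinitePlace ↥(maximalRealSubfield L) // v.IsReal},
      DPK (PosIdx (cmXV L dV hdV ι₁ v)) (NegIdx (cmXV L dV hdV ι₁ v)) (PosIdx (cmXW L dV dW hdW ι₁ v)) (NegIdx (cmXW L dV dW hdW ι₁ v)))
    (p : UnitaryGroup.arch (↥(maximalRealSubfield L)) L (IsCMField.complexConj L) N (Matrix.diagonal dV) ×
      UnitaryGroup.arch (↥(maximalRealSubfield L)) L (IsCMField.complexConj L) M (Matrix.diagonal dW))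
    (hh : ∀ v, κ (PosIdx (cmXV L dV hdV ι₁ v)) (NegIdx (cmXV L dV hdV ι₁ v)) (PosIdx (cmXW L dV dW hdW ι₁ v)) (NegIdx (cmXW L dV dW hdW ι₁ v))
      (h v) = cmPlaceComponent L dV hdV hdV0 dW hdW hdW0 ι₁ v p) :
    letterSection L dV hdV hdV0 dW hdW hdW0 ι₁ h = p :=
  eq_of_cmPlaceComponent_eq L dV hdV hdV0 dW hdW hdW0 ι₁ fun v => by rw [cmPlaceComponent_letterSection, hh]

end Components

/-! ## §3 The `w(ι₁)`-component of ANY archimedean element is that of the `ι₁`-section of its projection -/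

section IotaPlace

variable (L : Type) [Field L] [NumberField L] [IsCMField L] (H : Matrix (Fin 3) (Fin 3) L) (τ : L →+* ℂ) (T : GL (Fin 3) ℂ)
  (hT : formCongr (starRingEnd ℂ) T (H.map τ) = BallModel.J)

/-- **`k_{w(τ)} = untwist (T (π_τ k) T⁻¹)`** for EVERY `k ∈ U(H)(L ⊗ ℝ)` (tree `archLocalOfEmb_archAtEmb`, `π_τ = formEquivU21 ∘ archAtEmb`). -/
theorem archAt_cmPlace_eq_archLocalOfEmb (k : UnitaryGroup.arch (↥(maximalRealSubfield L)) L (IsCMField.complexConj L) 3 H) :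
    archAt (↥(maximalRealSubfield L)) L (IsCMField.complexConj L) 3 H (UnitaryGroup.cmPlace L τ) (UnitaryGroup.complexConj_smul_infinitePlace L _)
        (IsCMField.complexConj_ne_one L) k =
      archLocalOfEmb L 3 H τ (isComplex_mk_of_isCMField L τ) ((formEquivU21 L H τ T hT).symm (archProjU21EmbCM L H τ T hT k)) := by
  have h1 : archProjU21EmbCM L H τ T hT k = formEquivU21 L H τ T hT
      (archAtEmb (↥(maximalRealSubfield L)) L (IsCMField.complexConj L) 3 H τ (isComplex_mk_of_isCMField L τ)
        (UnitaryGroup.complexConj_smul_infinitePlace L _) (IsCMField.complexConj_ne_one L) k) := rfl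
  rw [h1, ContinuousMulEquiv.symm_apply_apply, archLocalOfEmb_archAtEmb]

/-- … as a matrix: `GL₃(embTwist L τ) (T · (π_τ k) · T⁻¹)`. -/
theorem coe_archAt_cmPlace (k : UnitaryGroup.arch (↥(maximalRealSubfield L)) L (IsCMField.complexConj L) 3 H) :
    ((archAt (↥(maximalRealSubfield L)) L (IsCMField.complexConj L) 3 H (UnitaryGroup.cmPlace L τ) (UnitaryGroup.complexConj_smul_infinitePlace L _)
        (IsCMField.complexConj_ne_one L) k : archLocal L 3 H (UnitaryGroup.cmPlace L τ)) : GL (Fin 3) ℂ) =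
      Matrix.GeneralLinearGroup.map (embTwist L τ) (T * (archProjU21EmbCM L H τ T hT k : GL (Fin 3) ℂ) * T⁻¹) := by
  rw [archAt_cmPlace_eq_archLocalOfEmb L H τ T hT, coe_archLocalOfEmb, coe_formEquivU21_symm_apply]

end IotaPlace

/-! ## §4 At the pin: every place component of `(frameG⁻¹ k frameG, 1)`, `k ∈ K_∞`, is a compact letter -/

section Generic

variable (L : Type) [Field L] [NumberField L] [IsCMField L] {N M : ℕ}
variable (dV : Fin N → L) (hdV : ∀ i, IsCMField.complexConj L (dV i) = dV i) (hdV0 : ∀ i, dV i ≠ 0)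
variable (dW : Fin M → L) (hdW : ∀ i, IsCMField.complexConj L (dW i) = dW i) (hdW0 : ∀ i, dW i ≠ 0)
variable (ι₁ : L →+* ℂ)

/-- the `W`-component of `(x, 1)` is `1` at every place. -/
theorem cmPlaceComponent_snd_one (v : {v : InfinitePlace ↥(maximalRealSubfield L) // v.IsReal})
    (x : UnitaryGroup.arch (↥(maximalRealSubfield L)) L (IsCMField.complexConj L) N (Matrix.diagonal dV)) :
    (cmPlaceComponent L dV hdV hdV0 dW hdW hdW0 ι₁ v
      (x, (1 : UnitaryGroup.arch (↥(maximalRealSubfield L)) L (IsCMField.complexConj L) M (Matrix.diagonal dW)))).2 = 1 := by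
  rw [cmPlaceComponent_snd, map_one]
  exact map_one _

/-- **off the place of `ι₁`, `V` is definite, so EVERY `V`-component is a compact letter** (`kV_surjective_of_isEmpty`). -/
theorem cmPlaceComponent_fst_mem_range_of_ne
    (hV : ∀ τ : L →+* ℂ, InfinitePlace.mk τ ≠ InfinitePlace.mk ι₁ → (∀ i, 0 < (τ (dV i)).re) ∨ ∀ i, (τ (dV i)).re < 0)
    {v : {v : InfinitePlace ↥(maximalRealSubfield L) // v.IsReal}} (hv : v ≠ cmPlace L ι₁)
    (p : UnitaryGroup.arch (↥(maximalRealSubfield L)) L (IsCMField.complexConj L) N (Matrix.diagonal dV) ×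
      UnitaryGroup.arch (↥(maximalRealSubfield L)) L (IsCMField.complexConj L) M (Matrix.diagonal dW)) :
    (cmPlaceComponent L dV hdV hdV0 dW hdW hdW0 ι₁ v p).1 ∈ (UForm.kV (PosIdx (cmXV L dV hdV ι₁ v)) (NegIdx (cmXV L dV hdV ι₁ v))).range :=
  UForm.kV_surjective_of_isEmpty
    (isEmpty_posIdx_or_negIdx_placeSignVec L dV hdV (cmSignConv_ne_zero L dV ι₁) ι₁ hV v fun h => hv (Subtype.ext h)) _

end Generic

section Pin

open HodgeCM HodgeCM.Model

variable {L : CMField} {ι₁ : L →+* ℂ} (V : HermSpace3 L ι₁) (S : StubTree.SeesawDatum L)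

/-- binder-2's `archFrameConj` (#40) IS carch-1's `archFrameCongr` (both are `x ↦ g_∞⁻¹ x g_∞`; compare adelic images). -/
theorem archFrameConj_eq_archFrameCongr {N : ℕ} (H : Matrix (Fin N) (Fin N) (L : Type)) (g : GL (Fin N) (L : Type)) (d : Fin N → (L : Type))
    (hg : ((g : Matrix (Fin N) (Fin N) (L : Type)).map (cmConjRingHom (L : Type)))ᵀ * H * (g : Matrix (Fin N) (Fin N) (L : Type)) =
      Matrix.diagonal d)
    (x : UnitaryGroup.arch (↥(maximalRealSubfield L)) (L : Type) (IsCMField.complexConj L) N H) :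
    archFrameConj (L : Type) N H g d hg x = archFrameCongr (L : Type) H g d hg x := by
  have h := (archToAdelic_archFrameCongr (L : Type) H g d hg x).trans (cmKTypeHom_archToAdelic (L : Type) N H g d hg x)
  have h' := congrArg (archPart (↥(maximalRealSubfield L)) (L : Type) (IsCMField.complexConj L) N (Matrix.diagonal d)) h
  rw [archPart_archToAdelic, archPart_archToAdelic] at h'
  exact h'.symm

/-- **the `w(ι₁)`-matrix of `frameG⁻¹ k frameG` for ANY `k ∈ U(V.Hm)(L ⊗ ℝ)`**: carch-1's `(D_s · tw(u) · D_s⁻¹)^{σ⁻¹,σ⁻¹}` at `u := π k`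
(`coe_map_embTwist_frameConj`), `π = archProjU21EmbCM … ι₁ V.sylvesterFrame`. -/
theorem coe_archAt_cmPlace_archFrameConj
    (k : UnitaryGroup.arch (↥(maximalRealSubfield L)) (L : Type) (IsCMField.complexConj L) 3 V.Hm) :
    (((archAt (↥(maximalRealSubfield L)) (L : Type) (IsCMField.complexConj L) 3 (Matrix.diagonal (frameD V))
        (UnitaryGroup.cmPlace (L : Type) ι₁) (UnitaryGroup.complexConj_smul_infinitePlace (L : Type) _) (IsCMField.complexConj_ne_one (L : Type))
        (archFrameConj (L : Type) 3 V.Hm (frameG V) (frameD V) (frame_congr V) k) :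
          archLocal (L : Type) 3 (Matrix.diagonal (frameD V)) (UnitaryGroup.cmPlace (L : Type) ι₁)) : GL (Fin 3) ℂ) :
            Matrix (Fin 3) (Fin 3) ℂ) =
      ((Matrix.diagonal fun j => ((V.sylvesterScale j : ℝ) : ℂ)) *
          (((archProjU21EmbCM (L : Type) V.Hm ι₁ V.sylvesterFrame (sylvesterFrame_formCongr V) k : U21) : GL (Fin 3) ℂ) :
              Matrix (Fin 3) (Fin 3) ℂ).map (embTwist (L : Type) ι₁) *
        Matrix.diagonal fun j => (((V.sylvesterScale j : ℝ) : ℂ))⁻¹).submatrix V.rationalFramePerm.symm V.rationalFramePerm.symm := by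
  rw [← coe_map_embTwist_frameConj V, archFrameConj_eq_archFrameCongr, coe_archAt_archFrameCongr,
    coe_archAt_cmPlace (L : Type) V.Hm ι₁ V.sylvesterFrame (sylvesterFrame_formCongr V), generalLinearGroup_map_embedding_mk]
  simp only [map_mul, map_inv]

/-- `ε_{v₁}⁻¹ (inl a) = a`, `ε_{v₁}⁻¹ (inr b) = b` (the sign frame is `sumCompl`). -/
theorem cmEpsV_symm_inl (v : {v : InfinitePlace ↥(maximalRealSubfield L) // v.IsReal})
    (a : PosIdx (cmXV (L : Type) (frameD V) (frameD_real V) ι₁ v)) :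
    (cmEpsV (L : Type) (frameD V) (frameD_real V) ι₁ v).symm (Sum.inl a) = a.1 := rfl

/-- (Ported verbatim from the HodgeCMPerL package; no docstring in the source.) -/
theorem cmEpsV_symm_inr (v : {v : InfinitePlace ↥(maximalRealSubfield L) // v.IsReal})
    (b : NegIdx (cmXV (L : Type) (frameD V) (frameD_real V) ι₁ v)) :
    (cmEpsV (L : Type) (frameD V) (frameD_real V) ι₁ v).symm (Sum.inr b) = b.1 := rfl

/-- **at the place of `ι₁`, the `V`-component of `(frameG⁻¹ k frameG, 1)` is a compact letter for `k ∈ K_∞`**: `π k ∈ Stab(x₀)` is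
block-diagonal and the Sylvester frame of record is `ι₁(frameG) · P_σ · D_s` (carch-1 #CA8), so the framed matrix is block-diagonal. -/
theorem cmPlaceComponent_fst_mem_range_cmPlace (k : ↥(KInfty V)) :
    (cmPlaceComponent (L : Type) (frameD V) (frameD_real V) (frameD_ne V) (dW S) (dW_real S) (dW_ne S) ι₁ (cmPlace (L : Type) ι₁)
        (archFrameConj (L : Type) 3 V.Hm (frameG V) (frameD V) (frame_congr V)
            (k : UnitaryGroup.arch (↥(maximalRealSubfield L)) (L : Type) (IsCMField.complexConj L) 3 V.Hm),
          (1 : UnitaryGroup.arch (↥(maximalRealSubfield L)) (L : Type) (IsCMField.complexConj L) 2 (Matrix.diagonal (dW S))))).1 ∈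
      (UForm.kV (PosIdx (cmXV (L : Type) (frameD V) (frameD_real V) ι₁ (cmPlace (L : Type) ι₁)))
        (NegIdx (cmXV (L : Type) (frameD V) (frameD_real V) ι₁ (cmPlace (L : Type) ι₁)))).range := by
  have hk : archProjU21EmbCM (L : Type) V.Hm ι₁ V.sylvesterFrame (sylvesterFrame_formCongr V) k • x₀ = x₀ :=
    (mem_archIsotropy_iff (L : Type) V.Hm ι₁ V.sylvesterFrame (sylvesterFrame_formCongr V) _).1 k.2
  set u : U21 := archProjU21EmbCM (L : Type) V.Hm ι₁ V.sylvesterFrame (sylvesterFrame_formCongr V) k with hu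
  -- the `w(ι₁)`-matrix, read at binder-2's place `cmPlaceOver (cmPlace ι₁) = w(ι₁)`
  have hX : ∀ i j : Fin 3,
      (((archAt (↥(maximalRealSubfield L)) (L : Type) (IsCMField.complexConj L) 3 (Matrix.diagonal (frameD V))
        (cmPlaceOver (L : Type) (cmPlace (L : Type) ι₁)) (cmPlaceOver_smul (L : Type) _) (IsCMField.complexConj_ne_one (L : Type))
        (archFrameConj (L : Type) 3 V.Hm (frameG V) (frameD V) (frame_congr V) k) :
          archLocal (L : Type) 3 (Matrix.diagonal (frameD V)) (cmPlaceOver (L : Type) (cmPlace (L : Type) ι₁))) : GL (Fin 3) ℂ) :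
            Matrix (Fin 3) (Fin 3) ℂ) i j =
        ((V.sylvesterScale (V.rationalFramePerm.symm i) : ℝ) : ℂ) *
          embTwist (L : Type) ι₁ (mat u (V.rationalFramePerm.symm i) (V.rationalFramePerm.symm j)) *
            (((V.sylvesterScale (V.rationalFramePerm.symm j) : ℝ) : ℂ))⁻¹ := by
    intro i j
    rw [coe_archAt_eq_of_eq V (cmPlaceOver_cmPlace_eq (L := L) (ι₁ := ι₁)) _ (UnitaryGroup.complexConj_smul_infinitePlace (L : Type) _),
      coe_archAt_cmPlace_archFrameConj, Matrix.submatrix_apply, Matrix.mul_diagonal, Matrix.diagonal_mul, Matrix.map_apply]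
  refine UForm.mem_range_kV_of_apply_eq_zero _ (fun a b => ?_) (fun a b => ?_)
  · rw [coe_cmPlaceComponent_fst, Matrix.reindex_apply, Matrix.submatrix_apply, cmEpsV_symm_inl, cmEpsV_symm_inr, scaleConj_apply, hX,
      (eq_perm_two_of_not_pos V) b.2, Equiv.symm_apply_apply]
    obtain ⟨m, hm⟩ := Fin.exists_castSucc_eq.2 ((perm_symm_ne_last_of_pos V) a.2)
    rw [← hm, mat_col_two_eq_zero_of_smul_x₀ hk m, map_zero, mul_zero, zero_mul, mul_zero, zero_mul]
  · rw [coe_cmPlaceComponent_fst, Matrix.reindex_apply, Matrix.submatrix_apply, cmEpsV_symm_inl, cmEpsV_symm_inr, scaleConj_apply, hX,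
      (eq_perm_two_of_not_pos V) b.2, Equiv.symm_apply_apply]
    obtain ⟨m, hm⟩ := Fin.exists_castSucc_eq.2 ((perm_symm_ne_last_of_pos V) a.2)
    rw [← hm, mat_row_two_eq_zero_of_smul_x₀ hk m, map_zero, mul_zero, zero_mul, mul_zero, zero_mul]

/-- **every `V`-place component of `(frameG⁻¹ k frameG, 1)`, `k ∈ K_∞`, is a compact letter.** -/
theorem cmPlaceComponent_fst_mem_range (k : ↥(KInfty V)) (v : {v : InfinitePlace ↥(maximalRealSubfield L) // v.IsReal}) :
    (cmPlaceComponent (L : Type) (frameD V) (frameD_real V) (frameD_ne V) (dW S) (dW_real S) (dW_ne S) ι₁ v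
        (archFrameConj (L : Type) 3 V.Hm (frameG V) (frameD V) (frame_congr V)
            (k : UnitaryGroup.arch (↥(maximalRealSubfield L)) (L : Type) (IsCMField.complexConj L) 3 V.Hm),
          (1 : UnitaryGroup.arch (↥(maximalRealSubfield L)) (L : Type) (IsCMField.complexConj L) 2 (Matrix.diagonal (dW S))))).1 ∈
      (UForm.kV (PosIdx (cmXV (L : Type) (frameD V) (frameD_real V) ι₁ v)) (NegIdx (cmXV (L : Type) (frameD V) (frameD_real V) ι₁ v))).range := by
  by_cases hv : v = cmPlace (L : Type) ι₁
  · subst hv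
    exact cmPlaceComponent_fst_mem_range_cmPlace V S k
  · exact cmPlaceComponent_fst_mem_range_of_ne (L : Type) (frameD V) (frameD_real V) (frameD_ne V) (dW S) (dW_real S) (dW_ne S) ι₁
      (frameD_sign_of_ne V) hv _

/-! ## §5 The lettering of `K_∞` -/

/-- the archimedean pair `(frameG⁻¹ k frameG, 1)` of `k ∈ K_∞` as a homomorphism (pointwise #48's `kPair`). -/
def kPairHom : ↥(KInfty V) →*
    UnitaryGroup.arch (↥(maximalRealSubfield L)) (L : Type) (IsCMField.complexConj L) 3 (Matrix.diagonal (frameD V)) ×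
      UnitaryGroup.arch (↥(maximalRealSubfield L)) (L : Type) (IsCMField.complexConj L) 2 (Matrix.diagonal (dW S)) :=
  ((archFrameConj (L : Type) 3 V.Hm (frameG V) (frameD V) (frame_congr V)).comp (KInfty V).subtype).prod 1

/-- (Ported verbatim from the HodgeCMPerL package; no docstring in the source.) -/
theorem kPairHom_apply (k : ↥(KInfty V)) :
    kPairHom V S k =
      (archFrameConj (L : Type) 3 V.Hm (frameG V) (frameD V) (frame_congr V)
          (k : UnitaryGroup.arch (↥(maximalRealSubfield L)) (L : Type) (IsCMField.complexConj L) 3 V.Hm),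
        (1 : UnitaryGroup.arch (↥(maximalRealSubfield L)) (L : Type) (IsCMField.complexConj L) 2 (Matrix.diagonal (dW S)))) := rfl

/-- the `V`-letters of `K_∞` at ONE place: the unique `(a, b) ∈ U(V⁺_v) × U(V⁻_v)` with `diag(a, b)` = the `V`-component. -/
def lettAt (v : {v : InfinitePlace ↥(maximalRealSubfield L) // v.IsReal}) :
    ↥(KInfty V) →*
      Matrix.unitaryGroup (PosIdx (cmXV (L : Type) (frameD V) (frameD_real V) ι₁ v)) ℂ ×
        Matrix.unitaryGroup (NegIdx (cmXV (L : Type) (frameD V) (frameD_real V) ι₁ v)) ℂ :=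
  (MonoidHom.ofInjective (UForm.kV_injective (α := PosIdx (cmXV (L : Type) (frameD V) (frameD_real V) ι₁ v))
      (β := NegIdx (cmXV (L : Type) (frameD V) (frameD_real V) ι₁ v)))).symm.toMonoidHom.comp
    ((((MonoidHom.fst _ _).comp (cmPlaceComponent (L : Type) (frameD V) (frameD_real V) (frameD_ne V) (dW S) (dW_real S) (dW_ne S) ι₁ v)).comp
        (kPairHom V S)).codRestrict _ fun k => cmPlaceComponent_fst_mem_range V S k v)

/-- **the letters ARE the `V`-components**: `kV (lettAt v k) = (cmPlaceComponent v (frameG⁻¹ k frameG, 1)).1`. -/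
theorem kV_lettAt (v : {v : InfinitePlace ↥(maximalRealSubfield L) // v.IsReal}) (k : ↥(KInfty V)) :
    UForm.kV _ _ (lettAt V S v k) =
      (cmPlaceComponent (L : Type) (frameD V) (frameD_real V) (frameD_ne V) (dW S) (dW_real S) (dW_ne S) ι₁ v (kPairHom V S k)).1 :=
  congrArg Subtype.val (MulEquiv.apply_symm_apply (MonoidHom.ofInjective (UForm.kV_injective
    (α := PosIdx (cmXV (L : Type) (frameD V) (frameD_real V) ι₁ v)) (β := NegIdx (cmXV (L : Type) (frameD V) (frameD_real V) ι₁ v)))) _)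

/-- **THE LETTERING OF `K_∞`** (input (c) of #48/#49): `k ↦ (v ↦ lettAt v k)`. -/
def lett : ↥(KInfty V) →*
    ∀ w : {v : InfinitePlace ↥(maximalRealSubfield L) // v.IsReal},
      Matrix.unitaryGroup (PosIdx (cmXV (L : Type) (frameD V) (frameD_real V) ι₁ w)) ℂ ×
        Matrix.unitaryGroup (NegIdx (cmXV (L : Type) (frameD V) (frameD_real V) ι₁ w)) ℂ :=
  MonoidHom.pi fun w => lettAt V S w

/-- (Ported verbatim from the HodgeCMPerL package; no docstring in the source.) -/
theorem lett_apply (k : ↥(KInfty V)) (w : {v : InfinitePlace ↥(maximalRealSubfield L) // v.IsReal}) : lett V S k w = lettAt V S w k := rfl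

/-- **the compact image of the full letter family `(lett k w, (1,1))` IS the place component of `(frameG⁻¹ k frameG, 1)`.** -/
theorem κ_lett_apply (k : ↥(KInfty V)) (w : {v : InfinitePlace ↥(maximalRealSubfield L) // v.IsReal}) :
    κ (PosIdx (cmXV (L : Type) (frameD V) (frameD_real V) ι₁ w)) (NegIdx (cmXV (L : Type) (frameD V) (frameD_real V) ι₁ w))
        (PosIdx (cmXW (L : Type) (frameD V) (dW S) (dW_real S) ι₁ w)) (NegIdx (cmXW (L : Type) (frameD V) (dW S) (dW_real S) ι₁ w))
        (lett V S k w, (1, 1)) =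
      cmPlaceComponent (L : Type) (frameD V) (frameD_real V) (frameD_ne V) (dW S) (dW_real S) (dW_ne S) ι₁ w (kPairHom V S k) := by
  refine Prod.ext ?_ ?_
  · exact kV_lettAt V S w k
  · rw [kPairHom_apply, cmPlaceComponent_snd_one]
    exact (UForm.kV _ _).map_one

/-- **`hlett` (input (c) of #48/#49) HOLDS for `lett`**: `letterSection (kVLetters (lett k)) = (frameG⁻¹ k frameG, 1)` for every `k ∈ K_∞`. -/
theorem letterSection_lett (k : ↥(KInfty V)) :
    letterSection (L : Type) (frameD V) (frameD_real V) (frameD_ne V) (dW S) (dW_real S) (dW_ne S) ι₁ (fun w => (lett V S k w, (1, 1))) =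
      (archFrameConj (L : Type) 3 V.Hm (frameG V) (frameD V) (frame_congr V)
          (k : UnitaryGroup.arch (↥(maximalRealSubfield L)) (L : Type) (IsCMField.complexConj L) 3 V.Hm),
        (1 : UnitaryGroup.arch (↥(maximalRealSubfield L)) (L : Type) (IsCMField.complexConj L) 2 (Matrix.diagonal (dW S)))) :=
  letterSection_eq_of_κ_eq (L : Type) (frameD V) (frameD_real V) (frameD_ne V) (dW S) (dW_real S) (dW_ne S) ι₁ _ _ fun w =>
    κ_lett_apply V S k w

end Pin



end HodgeCM.Model.HypCensus

end
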